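import Literature.Analysis.FluidPDE.MorreyLargeScale
import Literature.Analysis.FluidPDE.AncientLPSLiouvilleMild
import Literature.Analysis.FluidPDE.KNSSWeakDriftMild
import Literature.Analysis.FluidPDE.KNSSOseenMildDecayTools
import HarnessLib

/-!
# The parasitic drift of a bounded weak solution with Albritton–Barker's `A`-bound is constant

Analysis/FluidPDE proof file (theorems only; no definitions, no named facts).

Let `(U, b)` be a drift-mild pair on the window `(0, T)` (`IsKNSSDriftMild T N U b`,
`KNSSRegularityDecomposition.lean`): the output of Koch–Nadirashvili–Seregin–Šverák 2009, Lemma 3.1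
for a bounded weak Navier–Stokes solution `u = U + b(t)` on `ℝ³ × (0, T)` — `U` is the Oseen-mild
part `U(t) = e^{(t−s)Δ}U(s) − ∫ₛᵗ e^{(t−σ)Δ}P∇·(u ⊗ u) dσ` and `b` the bounded measurable "parasitic"
drift, determined up to a constant (KNSS Remark 3.1). Suppose that almost every slice of the full
velocity `u = U + b` obeys the scale-invariant Morrey bound at the origin at all large radii,
`∫_{B_r(0)} ‖u(σ)‖² ≤ I r` for `r ≥ r₀` — which is what Albritton–Barker's hypothesis `𝐈 < ∞`
(`A(Q((0,0), r)) ≤ 𝐈` for every `r`, with the essential supremum in time) says about a suitable weak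
solution on `ℝ³ × ℝ₋` (`ae_energy_ball_le_typeIBound`, `LocalTypeILiouville.lean`). Then:

* `IsKNSSDriftMild.drift_eq_of_morrey` — `b(t) = b(s)` for any two Morrey-good times `s < t`;
* `IsKNSSDriftMild.exists_ae_drift_eq_const_of_morrey` — `b` is a.e. equal to a constant `b₀`,
  `‖b₀‖ ≤ N`;
* `IsKNSSDriftMild.exists_zeroDrift_of_morrey` — absorbing the constant, `V = U + b₀` is a
  drift-mild field with ZERO drift on `(0, T)` (bound `N + N`), i.e. a genuine bounded solution of
  the Oseen integral equation (`IsKNSSDriftMild.eq_heatExtension_sub_oseenDuhamel_three`), and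
  `u(σ) = V(σ)` (everywhere in `x`) for a.e. `σ`.

This is the mildness step of the forward direction of Albritton–Barker 2019, Thm. 1.1 ("`𝐈 < ∞`"
excludes the parasitic solutions `u = b(t)` of KNSS 2009, §1, whose `A(Q(z,r)) ~ r² |b|²` is
unbounded), in the manner of KNSS 2009, proof of Thm. 6.1, last paragraph (p. 12: under a decay
assumption "all the terms in the decomposition `u = v + w + b` will again satisfy [it]. It follows
easily that `b` must vanish"). **The argument** (averaging at scale `√ρ → ∞` with the heat kernel):
apply `e^{ρΔ}(·)(0)` to the identity `u(t) = e^{(t−s)Δ}u(s) − B¹ₛ(u,u)(t) + (b(t) − b(s))`; by the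
semigroup law and the restart of the Duhamel integral through the heat flow
(`heatExtension_integral_sum_oseenHeat_duhamel`),
`b(t) − b(s) = e^{ρΔ}u(t)(0) − e^{(ρ+t−s)Δ}u(s)(0) + ∫ₛᵗ N_{t+ρ−σ}[u(σ), u(σ)](0) dσ`, and under the
Morrey bound the caloric terms are `O(ρ^{-1/2})` and every Oseen slice with clock `≥ ρ` is
`O(ρ^{-3/2})` (`MorreyLargeScale.lean`); let `ρ → ∞`.

## References

* D. Albritton, T. Barker, *On local Type I singularities of the Navier–Stokes equations and
  Liouville theorems*, J. Math. Fluid Mech. 21 (2019) = arXiv:1811.00502, Thm. 1.1, §3.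
  [AlbrittonBarker2019]
* G. Koch, N. Nadirashvili, G. Seregin, V. Šverák, *Liouville theorems for the Navier–Stokes
  equations and applications*, Acta Math. 203 (2009) = arXiv:0709.3599: §1 (parasitic solutions),
  Lemma 3.1 and Remark 3.1 (p. 7), §4 (4.3), proof of Thm. 6.1, last paragraph (p. 12).
  [KochNadirashviliSereginSverak2009]
-/

noncomputable section

open MeasureTheory Set Function Filter Metric
open _root_.Topology
open scoped NNReal ENNReal RealInnerProductSpace

namespace Literature.Analysis.FluidPDE

/-- Local notation for physical space `ℝ³ = EuclideanSpace ℝ (Fin 3)`. -/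
local notation "ℝ³" => EuclideanSpace ℝ (Fin 3)

/-! ### From integer radii to real radii -/

/-- **Morrey bound at integer radii ⟹ at real radii** (doubling the constant): if
`∫_{B_n(0)} ‖f‖² ≤ I n` for all integers `n ≥ n₀`, then `∫_{B_r(0)} ‖f‖² ≤ 2 I r` for all real
`r ≥ max n₀ 1` (use the ball of radius `⌈r⌉ ≤ r + 1 ≤ 2r`). [folklore] -/
theorem setLIntegral_ball_le_of_nat_morrey {F : Type*} [NormedAddCommGroup F] {f : ℝ³ → F} {I : ℝ}
    (hI : 0 ≤ I) {n₀ : ℕ}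
    (h : ∀ n : ℕ, n₀ ≤ n → ∫⁻ y in ball (0 : ℝ³) n, ‖f y‖ₑ ^ 2 ≤ ENNReal.ofReal (I * n)) :
    ∀ r : ℝ, max (n₀ : ℝ) 1 ≤ r →
      ∫⁻ y in ball (0 : ℝ³) r, ‖f y‖ₑ ^ 2 ≤ ENNReal.ofReal (2 * I * r) := by
  intro r hr
  have hr0 : 0 ≤ r := zero_le_one.trans ((le_max_right _ _).trans hr)
  have hn₀r : (n₀ : ℝ) ≤ r := (le_max_left _ _).trans hr
  set n : ℕ := ⌈r⌉₊ with hn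
  have hrn : r ≤ n := Nat.le_ceil r
  have hn₀n : n₀ ≤ n := by
    have : (n₀ : ℝ) ≤ n := hn₀r.trans hrn
    exact_mod_cast this
  have hn2r : (n : ℝ) ≤ 2 * r := by
    have h1 : (n : ℝ) < r + 1 := Nat.ceil_lt_add_one hr0
    have h2 : (1 : ℝ) ≤ r := (le_max_right _ _).trans hr
    linarith
  calc ∫⁻ y in ball (0 : ℝ³) r, ‖f y‖ₑ ^ 2
      ≤ ∫⁻ y in ball (0 : ℝ³) n, ‖f y‖ₑ ^ 2 := lintegral_mono_set (ball_subset_ball hrn)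
    _ ≤ ENNReal.ofReal (I * n) := h n hn₀n
    _ ≤ ENNReal.ofReal (2 * I * r) := ENNReal.ofReal_le_ofReal (by nlinarith)

/-! ### The drift is constant between Morrey-good times -/

section Drift

variable {T N : ℝ} {U : ℝ → ℝ³ → ℝ³} {b : ℝ → ℝ³}

/-- **The parasitic drift of a drift-mild pair is the same at any two Morrey-good times.** Let
`(U, b)` be drift-mild on `(0, T)` and suppose the full velocity `u = U + b` satisfies
`∫_{B_r(0)} ‖u(σ)‖² ≤ I r` for all `r ≥ r₀` (`r₀ ≥ 1`) at a.e. `σ ∈ (0, T)` and at the two times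
`0 < s < t < T`. Then `b(t) = b(s)`: heat-kernel averaging of
`u(t) = e^{(t−s)Δ}u(s) − B¹ₛ(u,u)(t) + (b(t) − b(s))` at scale `√ρ → ∞` (module docstring).
[cite: AlbrittonBarker2019, Thm 1.1 (forward direction, §3), after KochNadirashviliSereginSverak2009, proof of Thm 6.1, last paragraph (arXiv p. 12)] -/
theorem IsKNSSDriftMild.drift_eq_of_morrey (h : IsKNSSDriftMild T N U b) {I r₀ : ℝ} (hI : 0 ≤ I)
    (hr₀ : 1 ≤ r₀)
    (hae : ∀ᵐ σ ∂(volume.restrict (Ioo 0 T)), ∀ r : ℝ, r₀ ≤ r →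
      ∫⁻ y in ball (0 : ℝ³) r, ‖U σ y + b σ‖ₑ ^ 2 ≤ ENNReal.ofReal (I * r))
    {s t : ℝ} (hs : 0 < s) (hst : s < t) (htT : t < T)
    (hMs : ∀ r : ℝ, r₀ ≤ r → ∫⁻ y in ball (0 : ℝ³) r, ‖U s y + b s‖ₑ ^ 2 ≤ ENNReal.ofReal (I * r))
    (hMt : ∀ r : ℝ, r₀ ≤ r → ∫⁻ y in ball (0 : ℝ³) r, ‖U t y + b t‖ₑ ^ 2 ≤ ENNReal.ofReal (I * r)) :
    b t = b s := by
  have hE : Module.finrank ℝ ℝ³ = 3 := finrank_euclideanSpace_fin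
  set V : ℝ → ℝ³ → ℝ³ := fun σ y => U σ y + b σ with hV
  have hsT : s < T := hst.trans htT
  have htI : t ∈ Ioo 0 T := ⟨hs.trans hst, htT⟩
  have hsI : s ∈ Ioo 0 T := ⟨hs, hsT⟩
  have hN : 0 ≤ N := h.nonneg
  -- measurability and bounds of the slices
  have hUmeas : ∀ σ, Measurable (U σ) := fun σ =>
    h.measurable.comp (measurable_const.prodMk measurable_id)
  have hVmeas : ∀ σ, Measurable (V σ) := fun σ => (hUmeas σ).add_const _
  have hVbd : ∀ σ ∈ Ioo 0 T, ∀ y, ‖V σ y‖ ≤ N + N := fun σ hσ y =>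
    (norm_add_le _ _).trans (add_le_add (h.norm_le σ hσ y) (h.norm_drift_le σ))
  -- the `L¹`-Morrey bound of a Morrey-good slice
  set J : ℝ := Real.sqrt ((volume (ball (0 : ℝ³) 1)).toReal * I) with hJ
  have hJ0 : 0 ≤ J := Real.sqrt_nonneg _
  have hL1 : ∀ {σ : ℝ}, (∀ r : ℝ, r₀ ≤ r →
        ∫⁻ y in ball (0 : ℝ³) r, ‖V σ y‖ₑ ^ 2 ≤ ENNReal.ofReal (I * r)) →
      ∀ r : ℝ, r₀ ≤ r → ∫⁻ y in ball (0 : ℝ³) r, ‖V σ y‖ₑ ≤ ENNReal.ofReal (J * r ^ 2) :=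
    fun {σ} hM r hr => setLIntegral_enorm_ball_le_of_morrey (hVmeas σ).aestronglyMeasurable hI
      (by linarith) (hM r hr)
  obtain ⟨K₂, hK₂, hOs⟩ := exists_norm_oseenSlice_origin_le_of_morrey
  set K₁ : ℝ := 2048 * (4 * Real.pi) ^ (-(3 : ℝ) / 2) with hK₁
  have hK₁0 : 0 ≤ K₁ := by positivity
  set e := stdOrthonormalBasis ℝ ℝ³ with he
  -- ## the main estimate: for `ρ ≥ r₀²`, `‖b t − b s‖ ≤ C/√ρ`
  have hbound : ∀ ρ : ℝ, r₀ ^ 2 ≤ ρ →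
      ‖b t - b s‖ ≤ (2 * K₁ * J + K₂ * I * (t - s)) * (Real.sqrt ρ)⁻¹ := by
    intro ρ hρ
    have hρ1 : 1 ≤ ρ := le_trans (by nlinarith) hρ
    have hρ0 : 0 < ρ := by linarith
    have hsρ : r₀ ≤ Real.sqrt ρ := Real.le_sqrt_of_sq_le hρ
    have hsρ0 : 0 < Real.sqrt ρ := Real.sqrt_pos.2 hρ0
    -- (a) `e^{ρΔ}` applied to the drift-mild identity `U(t) = e^{(t−s)Δ}U(s) − D`
    set D : ℝ³ → ℝ³ := driftDuhamel U b s t with hD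
    have hmildfun : U t = fun x => UnboundedOperators.heatExtension (U s) (t - s) x - D x :=
      funext (h.mild s t hs hst htT)
    have hc1 : Continuous fun x => UnboundedOperators.heatExtension (U s) (t - s) x :=
      (UnboundedOperators.contDiff_heatExtension_holds (h.memLp_top_slice hsI) le_top
        (sub_pos.2 hst)).continuous
    have hc2 : Continuous D := h.continuous_driftDuhamel hE hs.le hst.le htT.le
    have hb1 : ∀ x, ‖UnboundedOperators.heatExtension (U s) (t - s) x‖ ≤ N := fun x =>
      UnboundedOperators.norm_heatExtension_le (fun z => h.norm_le s hsI z) (sub_pos.2 hst) x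
    have hb2 : ∀ x, ‖D x‖ ≤ 70632 * N ^ 2 * (t - s) ^ (1 / 2 : ℝ) := fun x =>
      h.norm_driftDuhamel_le hE hs.le hst.le htT.le x
    have hlin : UnboundedOperators.heatExtension (U t) ρ 0 =
        UnboundedOperators.heatExtension (fun x => UnboundedOperators.heatExtension (U s) (t - s) x) ρ 0 -
          UnboundedOperators.heatExtension D ρ 0 := by
      rw [hmildfun]
      exact UnboundedOperators.heatExtension_sub_of_bound hc1 hc2 hb1 hb2 hρ0 0
    -- the semigroup law
    have hsemi : UnboundedOperators.heatExtension
        (fun x => UnboundedOperators.heatExtension (U s) (t - s) x) ρ 0 =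
          UnboundedOperators.heatExtension (U s) (t - s + ρ) 0 := by
      have h1 := UnboundedOperators.heatExtension_add_holds (h.memLp_top_slice hsI) le_top
        (sub_pos.2 hst) hρ0
      exact congrFun h1 0
    -- the restart of the Duhamel integral through the heat flow
    have hB4 : ∀ σ ∈ Ioo s t, ∀ j k y, |driftTensor U b σ j k y| ≤ 4 * N ^ 2 := fun σ hσ =>
      h.abs_driftTensor_le ⟨hs.trans hσ.1, hσ.2.trans htT⟩
    have hrestart : UnboundedOperators.heatExtension D ρ 0 =
        ∫ σ in s..t, ∑ i, oseenHeat (t + ρ - σ) (driftTensor U b σ) i 0 • e i := by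
      have h1 := heatExtension_integral_sum_oseenHeat_duhamel hE h.measurable_driftTensor
        (by positivity : (0 : ℝ) ≤ 4 * N ^ 2) hst.le (show t < t + ρ by linarith) hB4 0
      rw [show t + ρ - t = ρ by ring] at h1
      exact h1
    -- adding the drift constants
    have hVt : UnboundedOperators.heatExtension (V t) ρ 0 =
        UnboundedOperators.heatExtension (U t) ρ 0 + b t :=
      heatExtension_add_const_apply (hUmeas t).aestronglyMeasurable (h.norm_le t htI) (b t) hρ0 0
    have hVs : UnboundedOperators.heatExtension (V s) (t - s + ρ) 0 =
        UnboundedOperators.heatExtension (U s) (t - s + ρ) 0 + b s :=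
      heatExtension_add_const_apply (hUmeas s).aestronglyMeasurable (h.norm_le s hsI) (b s)
        (by linarith) 0
    -- the identity for the drift increment
    have hkey : b t - b s = UnboundedOperators.heatExtension (V t) ρ 0 -
        UnboundedOperators.heatExtension (V s) (t - s + ρ) 0 +
          ∫ σ in s..t, ∑ i, oseenHeat (t + ρ - σ) (driftTensor U b σ) i 0 • e i := by
      rw [hVt, hVs, hlin, hsemi, hrestart]; abel
    -- (b) the three bounds
    have hB1 : ‖UnboundedOperators.heatExtension (V t) ρ 0‖ ≤ K₁ * J / Real.sqrt ρ :=
      norm_heatExtension_origin_le_of_morrey hρ0 hJ0 fun r hr => hL1 hMt r (hsρ.trans hr)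
    have hB2 : ‖UnboundedOperators.heatExtension (V s) (t - s + ρ) 0‖ ≤ K₁ * J / Real.sqrt ρ := by
      have hρ' : 0 < t - s + ρ := by linarith
      have h1 : ‖UnboundedOperators.heatExtension (V s) (t - s + ρ) 0‖ ≤
          K₁ * J / Real.sqrt (t - s + ρ) :=
        norm_heatExtension_origin_le_of_morrey hρ' hJ0 fun r hr =>
          hL1 hMs r ((hsρ.trans (Real.sqrt_le_sqrt (by linarith))).trans hr)
      exact h1.trans (div_le_div_of_nonneg_left (by positivity) hsρ0 (Real.sqrt_le_sqrt (by linarith)))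
    have hB3 : ‖∫ σ in s..t, ∑ i, oseenHeat (t + ρ - σ) (driftTensor U b σ) i 0 • e i‖ ≤
        K₂ * I * (Real.sqrt ρ / ρ ^ 2) * |t - s| := by
      refine intervalIntegral.norm_integral_le_of_norm_le_const_ae ?_
      have hae' := (ae_restrict_iff' (measurableSet_Ioo (a := (0 : ℝ)) (b := T))).1 hae
      filter_upwards [hae'] with σ hσ hσst
      rw [uIoc_of_le hst.le] at hσst
      have hσI : σ ∈ Ioo 0 T := ⟨hs.trans hσst.1, hσst.2.trans_lt htT⟩
      have hclock : 0 < t + ρ - σ := by linarith [hσst.2]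
      rw [sum_oseenHeat_smul_eq_oseenSlice hE (hVmeas σ) (hVmeas σ) (hVbd σ hσI) (hVbd σ hσI)
        (fun j k y => by simp only [driftTensor_apply, hV]) hclock 0]
      exact hOs hρ0 (by linarith [hσst.2]) hI fun r hr => hσ hσI r (hsρ.trans hr)
    -- (c) combine: `√ρ/ρ² ≤ 1/√ρ` for `ρ ≥ 1`
    have hrat : Real.sqrt ρ / ρ ^ 2 ≤ (Real.sqrt ρ)⁻¹ := by
      rw [div_le_iff₀ (by positivity), ← div_eq_inv_mul, le_div_iff₀ hsρ0, Real.mul_self_sqrt hρ0.le]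
      nlinarith
    calc ‖b t - b s‖
        = ‖UnboundedOperators.heatExtension (V t) ρ 0 -
            UnboundedOperators.heatExtension (V s) (t - s + ρ) 0 +
            ∫ σ in s..t, ∑ i, oseenHeat (t + ρ - σ) (driftTensor U b σ) i 0 • e i‖ := by rw [hkey]
      _ ≤ ‖UnboundedOperators.heatExtension (V t) ρ 0‖ +
            ‖UnboundedOperators.heatExtension (V s) (t - s + ρ) 0‖ +
            ‖∫ σ in s..t, ∑ i, oseenHeat (t + ρ - σ) (driftTensor U b σ) i 0 • e i‖ :=
          (norm_add_le _ _).trans (add_le_add (norm_sub_le _ _) le_rfl)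
      _ ≤ K₁ * J / Real.sqrt ρ + K₁ * J / Real.sqrt ρ + K₂ * I * (Real.sqrt ρ / ρ ^ 2) * |t - s| :=
          add_le_add (add_le_add hB1 hB2) hB3
      _ ≤ K₁ * J / Real.sqrt ρ + K₁ * J / Real.sqrt ρ + K₂ * I * (Real.sqrt ρ)⁻¹ * |t - s| := by
          gcongr
      _ = (2 * K₁ * J + K₂ * I * (t - s)) * (Real.sqrt ρ)⁻¹ := by
          rw [abs_of_pos (sub_pos.2 hst)]; ring
  -- ## the limit `ρ → ∞`
  have hlim : Tendsto (fun ρ : ℝ => (2 * K₁ * J + K₂ * I * (t - s)) * (Real.sqrt ρ)⁻¹) atTop (𝓝 0) := by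
    have h1 : Tendsto (fun ρ : ℝ => (Real.sqrt ρ)⁻¹) atTop (𝓝 0) :=
      tendsto_inv_atTop_zero.comp Real.tendsto_sqrt_atTop
    simpa only [mul_zero] using h1.const_mul (2 * K₁ * J + K₂ * I * (t - s))
  have hle : ‖b t - b s‖ ≤ 0 := ge_of_tendsto hlim (eventually_atTop.2 ⟨r₀ ^ 2, hbound⟩)
  exact sub_eq_zero.1 (norm_le_zero_iff.1 hle)

/-- **The parasitic drift is a.e. constant** under the a.e.-in-time Morrey bound at large integer
radii: there is `b₀` with `‖b₀‖ ≤ N` and `b(σ) = b₀` for a.e. `σ ∈ (0, T)`.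
[cite: AlbrittonBarker2019, Thm 1.1 (forward direction, §3), after KochNadirashviliSereginSverak2009, proof of Thm 6.1, last paragraph (arXiv p. 12)] -/
theorem IsKNSSDriftMild.exists_ae_drift_eq_const_of_morrey (h : IsKNSSDriftMild T N U b) {I : ℝ}
    (hI : 0 ≤ I) {n₀ : ℕ}
    (hae : ∀ᵐ σ ∂(volume.restrict (Ioo 0 T)), ∀ n : ℕ, n₀ ≤ n →
      ∫⁻ y in ball (0 : ℝ³) n, ‖U σ y + b σ‖ₑ ^ 2 ≤ ENNReal.ofReal (I * n)) :
    ∃ b₀ : ℝ³, ‖b₀‖ ≤ N ∧ ∀ᵐ σ ∂(volume.restrict (Ioo 0 T)), b σ = b₀ := by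
  -- real radii, constant `2I`, threshold `r₀ = max n₀ 1`
  set r₀ : ℝ := max (n₀ : ℝ) 1 with hr₀
  have hr₀1 : 1 ≤ r₀ := le_max_right _ _
  have hI2 : 0 ≤ 2 * I := by positivity
  set Good : ℝ → Prop := fun σ => ∀ r : ℝ, r₀ ≤ r →
    ∫⁻ y in ball (0 : ℝ³) r, ‖U σ y + b σ‖ₑ ^ 2 ≤ ENNReal.ofReal (2 * I * r) with hGood
  have hgood : ∀ᵐ σ ∂(volume.restrict (Ioo 0 T)), Good σ := by
    filter_upwards [hae] with σ hσ
    exact setLIntegral_ball_le_of_nat_morrey hI hσ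
  -- two good times carry the same drift
  have hpair : ∀ σ₁ ∈ Ioo 0 T, Good σ₁ → ∀ σ₂ ∈ Ioo 0 T, Good σ₂ → b σ₁ = b σ₂ := by
    intro σ₁ hσ₁ hG₁ σ₂ hσ₂ hG₂
    rcases lt_trichotomy σ₁ σ₂ with hlt | heq | hgt
    · exact (h.drift_eq_of_morrey hI2 hr₀1 hgood hσ₁.1 hlt hσ₂.2 hG₁ hG₂).symm
    · rw [heq]
    · exact h.drift_eq_of_morrey hI2 hr₀1 hgood hσ₂.1 hgt hσ₁.2 hG₂ hG₁
  by_cases hex : ∃ σ₀ ∈ Ioo 0 T, Good σ₀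
  · obtain ⟨σ₀, hσ₀, hG₀⟩ := hex
    refine ⟨b σ₀, h.norm_drift_le σ₀, ?_⟩
    filter_upwards [hgood, ae_restrict_mem measurableSet_Ioo] with σ hσ hσI
    exact hpair σ hσI hσ σ₀ hσ₀ hG₀
  · -- no good time in the window: the window is null
    refine ⟨0, by simpa using h.nonneg, ?_⟩
    filter_upwards [hgood, ae_restrict_mem measurableSet_Ioo] with σ hσ hσI
    exact absurd ⟨σ, hσI, hσ⟩ hex

/-- **Absorbing the constant drift: a zero-drift Oseen-mild field.** Under the a.e.-in-time Morrey
bound at large integer radii, the drift-mild pair `(U, b)` yields `V = U + b₀`, drift-mild with ZERO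
drift on `(0, T)` (bound `N + N`) — a bounded solution of the Oseen integral equation restarted at
every time — with `U(σ) + b(σ) = V(σ)` (everywhere in space) for a.e. `σ ∈ (0, T)`.
[cite: AlbrittonBarker2019, Thm 1.1 (forward direction, §3), after KochNadirashviliSereginSverak2009, Lemma 3.1, Remark 3.1 and proof of Thm 6.1 (arXiv pp. 7, 12)] -/
theorem IsKNSSDriftMild.exists_zeroDrift_of_morrey (h : IsKNSSDriftMild T N U b) {I : ℝ}
    (hI : 0 ≤ I) {n₀ : ℕ}
    (hae : ∀ᵐ σ ∂(volume.restrict (Ioo 0 T)), ∀ n : ℕ, n₀ ≤ n →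
      ∫⁻ y in ball (0 : ℝ³) n, ‖U σ y + b σ‖ₑ ^ 2 ≤ ENNReal.ofReal (I * n)) :
    ∃ V : ℝ → ℝ³ → ℝ³, IsKNSSDriftMild T (N + N) V 0 ∧
      ∀ᵐ σ ∂(volume.restrict (Ioo 0 T)), ∀ y, U σ y + b σ = V σ y := by
  have hE : Module.finrank ℝ ℝ³ = 3 := finrank_euclideanSpace_fin
  obtain ⟨b₀, hb₀, hconst⟩ := h.exists_ae_drift_eq_const_of_morrey hI hae
  have hN : 0 ≤ N := h.nonneg
  have hUmeas : ∀ σ, Measurable (U σ) := fun σ =>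
    h.measurable.comp (measurable_const.prodMk measurable_id)
  set V : ℝ → ℝ³ → ℝ³ := fun σ y => U σ y + b₀ with hV
  refine ⟨V, ⟨measurable_const, fun _ => by simpa using add_nonneg hN hN, ?_, ?_, ?_, ?_⟩, ?_⟩
  · exact h.measurable.add_const b₀
  · intro σ hσ y
    exact (norm_add_le _ _).trans (add_le_add (h.norm_le σ hσ y) hb₀)
  · filter_upwards [h.ae_isWeaklyDivFree, ae_restrict_mem measurableSet_Ioo] with σ hσ hσI
    have e1 : V σ = U σ - fun _ => -b₀ := by funext y; simp [hV]
    rw [e1]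
    exact hσ.sub_of_locallyIntegrable (isWeaklyDivFree_const (-b₀))
      (h.continuous_slice hE hσI).locallyIntegrable continuous_const.locallyIntegrable
  · intro s t hs hst htT x
    have hsI : s ∈ Ioo 0 T := ⟨hs, hst.trans htT⟩
    have hheat : UnboundedOperators.heatExtension (V s) (t - s) x =
        UnboundedOperators.heatExtension (U s) (t - s) x + b₀ :=
      heatExtension_add_const_apply (hUmeas s).aestronglyMeasurable (h.norm_le s hsI) b₀
        (sub_pos.2 hst) x
    have hdrift : driftDuhamel U b s t x = driftDuhamel V 0 s t x := by
      refine driftDuhamel_congr_ae hst.le ?_ x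
      have h1 : ∀ᵐ σ ∂(volume.restrict (Ioo s t)), b σ = b₀ :=
        ae_restrict_of_ae_restrict_of_subset (Ioo_subset_Ioo hs.le htT.le) hconst
      filter_upwards [h1] with σ hσ
      exact Eventually.of_forall fun y => by simp [hV, hσ]
    show U t x + b₀ = _
    rw [h.mild s t hs hst htT x, hheat, hdrift]
    abel
  · filter_upwards [hconst] with σ hσ y
    simp [hV, hσ]

end Drift

end Literature.Analysis.FluidPDE

end
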